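import Mathlib
import Literature.Computability.MetaComplexity.SmolenskyDimensionBound
import Literature.Probability.RandomGraphs.LowDegree
import Summits.QuantumAdvantage.QuantumAdvantage.Theorems.MobiusLadderQuadraticDigitPhasesStubOneCutKataiCS

/-!
# Degree `≤ 1` functions on the cube over `𝔽₂` have `±` Walsh phases

Degree `≤ 1` functions on the Boolean cube over `𝔽₂` — the elements of Smolensky's degree
filtration `lowDeg (ZMod 2) n 1 = span {x_S : |S| ≤ 1}` — are affine, `h(b) = a + Σᵢ vᵢ [bᵢ]`,
so their `±1` phases are `±` Walsh characters: `(-1)^{h(b)} = (-1)^a · χ_S(b)` with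
`S = {i : vᵢ = 1}` and `χ_S(b) = Π_{i ∈ S} (-1)^{bᵢ}`. Wave-2 support of line Sketch/LAR (LAR at
level 1 from Bourgain's Walsh bound), crux stmt-QuantumAdvantage-1392: it identifies the level-1
phases `(-1)^{[h b = 1]}`, `h ∈ lowDeg (ZMod 2) n 1`, with `±` Walsh characters so that the proved
route item `WalshLiouvilleBound` applies. The sign bookkeeping `(-1)^{e+f} = (-1)^e (-1)^f`,
`(-1)^{Σ eᵢ} = Π (-1)^{eᵢ}` (`sign_add`, `sign_sum`) is reused from the one-cut Kátai lemmas of the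
sibling crux `MobiusLadder.QuadraticDigitPhases`.
-/

namespace Summit.QuantumAdvantage.DigitPolyUniformity.SketchLAR

open Finset Module
open Literature.Computability.MetaComplexity.Smolensky (CubeFn mono lowDeg)
open Literature.Probability.RandomGraphs.LowDegree (walsh)
open Summit.QuantumAdvantage.QuantumAdvantage.Theorems.MobiusLadderQuadraticDigitPhasesStubOneCutKatai
  (sign_add sign_sum)

namespace LowDegOneWalsh

open Literature.Probability.RandomGraphs.LowDegree (sgn)

/-- On a single bit `[c] ∈ {0,1} ⊆ 𝔽₂`, the phase of `v · [c]` is `sgn c = (-1)^{[c]}` if `v = 1`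
and `1` if `v = 0`. [folklore] -/
theorem phase_mul_bit (v : ZMod 2) (c : Bool) :
    (if v * (if c then 1 else 0) = 1 then (-1 : ℝ) else 1) = if v = 1 then sgn c else 1 := by
  have key : ∀ u : ZMod 2, u = 0 ∨ u = 1 := by decide
  have h01 : (0 : ZMod 2) ≠ 1 := by decide
  rcases key v with rfl | rfl <;> cases c <;> simp [h01]

/-- **Degree `≤ 1` functions on the cube are affine**: an element of `lowDeg F n 1` (the span of
the monomials `x_S`, `|S| ≤ 1`, i.e. of `1` and the coordinate functions `xᵢ`) is of the form
`b ↦ a + Σᵢ vᵢ [bᵢ]`. [folklore] -/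
theorem exists_affine_of_mem_lowDeg_one {F : Type*} [Field F] {n : ℕ} {h : CubeFn F n}
    (hh : h ∈ lowDeg F n 1) :
    ∃ a : F, ∃ v : Fin n → F, ∀ b : Fin n → Bool,
      h b = a + ∑ i, v i * (if b i then (1 : F) else 0) := by
  rw [Literature.Computability.MetaComplexity.Smolensky.lowDeg_eq_span] at hh
  induction hh using Submodule.span_induction with
  | mem x hx =>
    obtain ⟨⟨S, hS⟩, rfl⟩ := hx
    have hcard : S.card = 0 ∨ S.card = 1 := by omega
    rcases hcard with h0 | h1
    · rw [Finset.card_eq_zero] at h0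
      subst h0
      refine ⟨1, 0, fun b => ?_⟩
      simp
    · obtain ⟨j, rfl⟩ := Finset.card_eq_one.1 h1
      refine ⟨0, fun i => if i = j then 1 else 0, fun b => ?_⟩
      simp only [boole_mul]
      rw [Finset.sum_ite_eq_of_mem' _ _ _ (Finset.mem_univ j), zero_add]
      simp [mono]
  | zero => exact ⟨0, 0, fun b => by simp⟩
  | add x y _ _ hx hy =>
    obtain ⟨a₁, v₁, h₁⟩ := hx
    obtain ⟨a₂, v₂, h₂⟩ := hy
    refine ⟨a₁ + a₂, v₁ + v₂, fun b => ?_⟩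
    rw [Pi.add_apply, h₁ b, h₂ b]
    simp only [Pi.add_apply, add_mul, Finset.sum_add_distrib]
    ring
  | smul c x _ hx =>
    obtain ⟨a, v, hv⟩ := hx
    refine ⟨c * a, fun i => c * v i, fun b => ?_⟩
    rw [Pi.smul_apply, smul_eq_mul, hv b, mul_add, Finset.mul_sum]
    simp only [mul_assoc]

end LowDegOneWalsh

/-- **Degree `≤ 1` functions on the cube over `𝔽₂` have `±` Walsh phases**: for
`h ∈ lowDeg (ZMod 2) n 1` there are `S ⊆ [n]` and a sign `c = ±1` with
`(-1)^{[h(b) = 1]} = c · χ_S(b)` for every `b ∈ {0,1}ⁿ` (write `h(b) = a + Σ_{i ∈ S} [bᵢ]`; then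
`c = (-1)^a`). [folklore] -/
theorem stub_lowDeg_one_walsh {n : ℕ} (h : CubeFn (ZMod 2) n) (hh : h ∈ lowDeg (ZMod 2) n 1) :
    ∃ S : Finset (Fin n), ∃ c : ℝ, (c = 1 ∨ c = -1) ∧
      ∀ b : Fin n → Bool, (if h b = 1 then (-1 : ℝ) else 1) = c * walsh S b := by
  obtain ⟨a, v, hv⟩ := LowDegOneWalsh.exists_affine_of_mem_lowDeg_one hh
  refine ⟨univ.filter fun i => v i = 1, if a = 1 then -1 else 1, ?_, fun b => ?_⟩
  · split_ifs <;> simp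
  · rw [hv b, sign_add, sign_sum]
    congr 1
    rw [walsh, Finset.prod_filter]
    exact Finset.prod_congr rfl fun i _ => LowDegOneWalsh.phase_mul_bit (v i) (b i)

end Summit.QuantumAdvantage.DigitPolyUniformity.SketchLAR
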